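import Literature.Computability.Cryptography.LWEHardness
import Literature.Computability.Cryptography.StatisticalDistance
import Literature.Computability.Cryptography.CryptoFoundationsWave0
import Literature.Algebra.EuclideanLattices.PQCDiscreteGaussian
import Literature.Algebra.EuclideanLattices.SmoothingParameterSuccMin
import HarnessLib

/-!
# Regev's quantum reduction: the architecture of the proof of `regev_lwe_to_sivp_quantum`

The named fact `Literature.Computability.Cryptography.regev_lwe_to_sivp_quantum` (pqc.S19, file
`LWEHardness.lean`; Regev, J. ACM 56 (2009), Thm 1.1 / Thm 3.1, SIVP form) is the composite of
three printed results of that paper: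

* **Thm 3.1 (main theorem)**: an LWE oracle yields an efficient *quantum* sampler for the discrete
  Gaussian sampling problem `DGS_{√(2n)·η_ε(L)/α}` (`ε` negligible) — hypothesis `hB` of the
  assembly theorem below, in the machine form `∃ D ν, IsNegligible ν ∧ D.SamplesDGS
  (regevDGSBound α ε) ν` (with the standard average-case-to-worst-case bridge folded into its
  hypothesis, see "Faithfulness notes");
* **Lemma 3.17**: for `ε ≤ 1/10` and `φ ≥ √2 η_ε`, `GIVP_{2√n φ}` reduces in polynomial time to
  `DGS_φ` — hypothesis `hC`, in the machine form `D.SamplesDGS φ ν → ∃ G, G.SolvesGIVP (2√n φ)`;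
* **Lemma 2.12** (= Micciancio–Regev 2007, Lemma 3.3): `η_ε(L) ≤ √(ln(2n(1+1/ε))/π) · λₙ(L)`;
  this is PROVED in the tree
  (`Literature.Algebra.EuclideanLattices.smoothingParameter_le_sqrt_log_mul_successiveMinimum_holds`).

The main content of this file is the PROVED conditional assembly
`regev_lwe_to_sivp_quantum_of_dgs (hB : ⟨Thm 3.1⟩) (hC : ⟨Lemma 3.17⟩) :
regev_lwe_to_sivp_quantum q α m`: with `ε(n) = e^{-(ln n)²}/10` (negligible, `≤ 1/10`) the
`GIVP_{2√n φ}` solution for `φ = √(2n) η_ε(L)/α` consists of `n` linearly independent lattice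
vectors of norm `≤ 2√2 · n · η_ε(L)/α ≤ γ(n) · λₙ(L)` with
`γ(n) = max(1, 2√2 · n · √(ln(2n(1+1/ε(n)))/π) / α(n)) = O(n log n / α) = Õ(n/α)`.
So the trust base of pqc.S19 is reduced to Regev's Thm 3.1 and Lemma 3.17 in the machine forms
`hB`, `hC` (no new named fact is introduced here; the two statements are the natural children of
a split of pqc.S19, and their own proof DAG — Regev 2009, Lemmas 3.2–3.16, 4.3 — is recorded in
the docstring of the assembly theorem).

## Notions introduced (thin glue on G11's `UniformQCircuitFamily`)

* `decodeLatticeVector n w`: prefix-tolerant reader of an integer vector off a measured register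
  (first `boolPair` component, then `Literature.Algebra.EuclideanLattices.decodeIntVec`).
* `UniformQCircuitFamily.outputVectorLaw`, `UniformQCircuitFamily.SamplesDGS D φ ν`: the family
  `D`, fed the code of `(B, r)` (`r : ℚ`, the code of `GapSVPInstance = LatticeInstance × ℚ` is
  re-used for the pair), outputs a vector whose law is within total variation `ν n` of the
  discrete Gaussian `D_{L(B), r}` (`Literature.Algebra.EuclideanLattices.discreteGaussian`,
  Micciancio–Regev 2007 §2) for every nonsingular `B` of large dimension `n` and every `r > φ(B)`:
  Regev's `DGS_φ` (Def. 2.9) solved by a quantum algorithm, up to negligible statistical distance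
  (Regev, §2, p. 11: "essentially all algorithms and reductions in this paper have an
  exponentially small error probability").
* `GIVP.IsSolution b B v`: `v₁,…,vₙ` are linearly independent vectors of `L(B)` of norm `≤ b`
  (Regev Def. 2.8, `GIVP^φ_γ` with bound `b = γ(n) φ(L)`); `SIVP.IsSolution γ B v` is literally
  `GIVP.IsSolution (γ n · λₙ(L(B))) B v` (`sivp_isSolution_iff_givp`);
  `UniformQCircuitFamily.SolvesGIVP G b`: on every nonsingular instance `B` of large dimension the
  family `G` outputs (the `decodeIntMatrix` code of) a `GIVP` solution with bound `b B` with
  probability `≥ 2/3` (the success format of pqc.S19).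
* `regevDGSBound α ε B = √(2n) · η_{ε(n)}(L(B)) / α(n)`: the Gaussian parameter of Thm 3.1.

## Faithfulness notes

* Regev's "an algorithm solves `LWE_{p,χ}`" means: for EVERY `s`, given (polynomially many)
  samples from `A_{s,χ}`, it outputs `s` with probability exponentially close to `1` (§2, p. 12,
  "Learning with errors"). pqc.S19 (and hence hypothesis `hB`) assumes instead ONE
  poly-time uniform quantum family with AVERAGE-case (uniform `s`) success probability `≥ 2/3`
  on `m(n)` samples. The bridge is standard and uses only the paper's own tools: the shift
  `(a, b) ↦ (a, b + ⟨a, t⟩)` maps `A_{s,χ}` to `A_{s+t,χ}` with `s + t` uniform (proof of Lemma 4.1),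
  `n` independent repetitions with fresh shifts, and the verification procedure of Lemma 3.6
  (candidates are checked, so a success probability `≥ 1/2` per call suffices, exactly as in the
  proof of Lemma 3.7); Lemma 4.3 passes from `Ψ̄_α` (discretised, as in pqc.S19) to `Ψ_α`. So
  `hB` is Thm 3.1 composed with this bridge.
* Regev allows an arbitrary integer modulus `p` (§2, p. 12); `hB` keeps only the uniformity
  hypothesis `IsPolyTimeParams` (parameters computable from `1ⁿ` in polynomial time, which bounds
  the bit length of `q n` polynomially), not `IsPolyBounded q`.
* Lemma 3.17 is a classical polynomial-time (Cook) reduction calling the `DGS` oracle `n²(2n+1)`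
  times after an LLL preprocessing; `hC` states the composed consequence
  for quantum `DGS` samplers with negligible error (the oracle calls cost a negligible total error),
  with success probability `≥ 2/3` (Regev: exponentially close to `1`) and hypotheses only for
  large dimensions (the conclusion is eventual in the dimension anyway).

## References

* O. Regev, *On lattices, learning with errors, random linear codes, and cryptography*, J. ACM 56
  (2009), art. 34 (arXiv:2401.03703): §2 (Defs. 2.7–2.9, Lemma 2.12, p. 12 "Learning with
  errors"), Thm 3.1, Lemmas 3.2–3.7, 3.11, 3.14, 3.17, Cor. 3.16, Lemmas 4.1, 4.3.
* D. Micciancio, O. Regev, *Worst-case to average-case reductions based on Gaussian measures*,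
  SIAM J. Comput. 37 (2007), §2 (discrete Gaussian), Def. 3.1, Lemma 3.3.
-/

noncomputable section

open Filter Asymptotics Literature.Computability.Complexity Literature.Computability.Cryptography.LWE
  Literature.Algebra.EuclideanLattices
open scoped ENNReal

namespace Literature.Computability.Cryptography

/-! ### Reading lattice vectors off measured registers -/

/-- Prefix-tolerant reader of an integer vector of dimension `n` off a bit string: the first
`boolPair` component of `w` decoded with `Literature.Algebra.EuclideanLattices.decodeIntVec n`
(JUNK value `0` on malformed words, inherited). Trailing bits (the rest of a measured quantum
register) are ignored, cf. `decodeIntMatrix`. [Arora–Barak 2009, §0.1] [cite: AroraBarak2009, §0.1] -/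
def decodeLatticeVector (n : ℕ) (w : List Bool) : Fin n → ℤ :=
  decodeIntVec n (boolUnpair w).1

/-- `decodeLatticeVector` inverts the self-delimited vector code, ignoring trailing bits. [folklore] -/
@[simp] theorem decodeLatticeVector_boolPair (n : ℕ) (v : Fin n → ℤ) (w : List Bool) :
    decodeLatticeVector n (boolPair (encodeIntVec ⟨n, v⟩) w) = v := by
  simp [decodeLatticeVector]

/-! ### Quantum samplers for the discrete Gaussian sampling problem `DGS_φ` -/

namespace UniformQCircuitFamily

/-- The law, on `ℝⁿ`, of the integer vector read off (`decodeLatticeVector n`) the measured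
register of the uniform quantum family `D` run on the classical input `x`.
[Regev 2009, Def. 2.9 (output of a `DGS` algorithm)] [cite: Regev2009, Def. 2.9] -/
def outputVectorLaw (D : UniformQCircuitFamily) (n : ℕ) (x : List Bool) :
    PMF (EuclideanSpace ℝ (Fin n)) :=
  (D.kernel x).map fun w => intVecToEuclidean n (decodeLatticeVector n w)

/-- `D.SamplesDGS φ ν`: the poly-time uniform quantum family `D` *solves the discrete Gaussian
sampling problem `DGS_φ` up to statistical distance `ν`*: for all large `n`, for every
nonsingular integer lattice instance `B` of dimension `n` and every rational `r > φ(B)`, fed the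
code of the pair `(B, r)` (the `GapSVPInstance` code), the law of its output vector is within
total variation distance `ν n` of the discrete Gaussian `D_{L(B), r}`
(`Literature.Algebra.EuclideanLattices.discreteGaussian (L(B)) r 0`, pushed into `ℝⁿ`). Regev's
`DGS_φ` (Def. 2.9: given `L` and `r > φ(L)`, output a sample from `D_{L,r}`), for quantum
algorithms whose output is correct up to a (negligible) statistical error, as all algorithms of
the paper are (§2, p. 11). [cite: Regev2009, Def. 2.9] -/
def SamplesDGS (D : UniformQCircuitFamily) (φ : LatticeInstance → ℝ) (ν : ℕ → ℝ) : Prop :=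
  ∀ᶠ n in atTop, ∀ (I : LatticeInstance) (r : ℚ), I.n = n → I.IsNonsingular → φ I < r →
    (D.outputVectorLaw I.n (GapSVPInstance.encode (I, r))).tvDist
      ((discreteGaussian I.lattice (r : ℝ) 0).map Subtype.val) ≤ ν n

/-- Unfolding of `SamplesDGS`. [folklore] -/
theorem samplesDGS_iff (D : UniformQCircuitFamily) (φ : LatticeInstance → ℝ) (ν : ℕ → ℝ) :
    D.SamplesDGS φ ν ↔
      ∀ᶠ n in atTop, ∀ (I : LatticeInstance) (r : ℚ), I.n = n → I.IsNonsingular → φ I < r →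
        (D.outputVectorLaw I.n (GapSVPInstance.encode (I, r))).tvDist
          ((discreteGaussian I.lattice (r : ℝ) 0).map Subtype.val) ≤ ν n :=
  Iff.rfl

/-- A sampler above `φ` is a sampler above any eventually larger bound `φ'` (fewer admissible
`r`). [Regev 2009, Def. 2.9] [folklore] -/
theorem SamplesDGS.mono {D : UniformQCircuitFamily} {φ φ' : LatticeInstance → ℝ} {ν : ℕ → ℝ}
    (h : D.SamplesDGS φ ν)
    (hφ : ∀ᶠ n in atTop, ∀ I : LatticeInstance, I.n = n → I.IsNonsingular → φ I ≤ φ' I) :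
    D.SamplesDGS φ' ν := by
  filter_upwards [h, hφ] with n hn hφn I r hIn hI hr
  exact hn I r hIn hI ((hφn I hIn hI).trans_lt hr)

/-- Kernel probabilities of a uniform family are monotone in the event. [folklore] -/
theorem kernelProb_mono (Q : UniformQCircuitFamily) (x : List Bool) {E F : Set (List Bool)}
    (h : E ⊆ F) : Q.kernelProb x E ≤ Q.kernelProb x F := by
  rw [kernelProb_eq, kernelProb_eq]
  refine ENNReal.toReal_mono (ne_top_of_le_ne_top ENNReal.one_ne_top ?_)
    ((Q.kernel x).toOuterMeasure.mono h)
  rw [← ((Q.kernel x).toOuterMeasure_apply_eq_one_iff Set.univ).2 (Set.subset_univ _)]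
  exact (Q.kernel x).toOuterMeasure.mono (Set.subset_univ _)

end UniformQCircuitFamily

/-! ### The generalized independent vectors problem `GIVP` -/

namespace GIVP

/-- `v₁, …, vₙ ∈ ℤⁿ` solve the generalized independent vectors problem on the instance `B` with
length bound `b`: they are linearly independent vectors of `L(B)` of norm at most `b`. Regev's
`GIVP^φ_γ` (Def. 2.8) asks for the bound `b = γ(n) · φ(L(B))`; `SIVP_γ` is the case `φ = λₙ`
(`sivp_isSolution_iff_givp`). [cite: Regev2009, Def. 2.8] -/
def IsSolution (b : ℝ) (I : LatticeInstance) (v : Fin I.n → Fin I.n → ℤ) : Prop :=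
  LinearIndependent ℤ v ∧ (∀ i, intVecToEuclidean I.n (v i) ∈ I.lattice) ∧
    ∀ i, ‖intVecToEuclidean I.n (v i)‖ ≤ b

/-- Monotonicity of `GIVP` solutions in the length bound. [Regev 2009, Def. 2.8] [folklore] -/
theorem IsSolution.mono {b b' : ℝ} (h : b ≤ b') {I : LatticeInstance} {v : Fin I.n → Fin I.n → ℤ}
    (hv : IsSolution b I v) : IsSolution b' I v :=
  ⟨hv.1, hv.2.1, fun i => (hv.2.2 i).trans h⟩

end GIVP

/-- `SIVP_γ` is `GIVP` with the bound `γ(n) · λₙ(L(B))` (Regev 2009, Defs. 2.7–2.8: "choosing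
`φ = λₙ` results in `SIVP`"). [cite: Regev2009, Def. 2.8] -/
theorem sivp_isSolution_iff_givp (γ : ℕ → ℝ) (I : LatticeInstance) (v : Fin I.n → Fin I.n → ℤ) :
    SIVP.IsSolution γ I v ↔ GIVP.IsSolution (γ I.n * successiveMinimum I.lattice I.n) I v :=
  Iff.rfl

/-! ### Solving `GIVP`; the Gaussian parameter of Thm 3.1 -/

namespace UniformQCircuitFamily

/-- `G.SolvesGIVP b`: the poly-time uniform quantum family `G` *solves the generalized independent
vectors problem with length bound `b`* in the success format of pqc.S19: for all large `n`, on
every nonsingular integer instance `B` of dimension `n` (fed as `B.encode`) it outputs the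
`decodeIntMatrix` code of `n` linearly independent vectors of `L(B)` of norm `≤ b B` with
probability `≥ 2/3`. (Regev 2009, Def. 2.8, `GIVP^φ_γ`: bound `b = γ(n) φ(L)`; `SIVP_γ` is
`b B = γ(n) λₙ(L(B))`, `solvesGIVP_iff_sivp`.) [cite: Regev2009, Def. 2.8] -/
def SolvesGIVP (G : UniformQCircuitFamily) (b : LatticeInstance → ℝ) : Prop :=
  ∀ᶠ n in atTop, ∀ I : LatticeInstance, I.n = n → I.IsNonsingular →
    2 / 3 ≤ G.kernelProb I.encode {w | GIVP.IsSolution (b I) I (decodeIntMatrix I.n w)}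

/-- With the bound `b B = γ(n) · λₙ(L(B))`, `SolvesGIVP` is literally the conclusion of pqc.S19
(`regev_lwe_to_sivp_quantum`) about the family `G`. [Regev 2009, Defs. 2.7–2.8] [folklore] -/
theorem solvesGIVP_iff_sivp (G : UniformQCircuitFamily) (γ : ℕ → ℝ) :
    G.SolvesGIVP (fun I => γ I.n * successiveMinimum I.lattice I.n) ↔
      ∀ᶠ n in atTop, ∀ I : LatticeInstance, I.n = n → I.IsNonsingular →
        2 / 3 ≤ G.kernelProb I.encode {w | SIVP.IsSolution γ I (decodeIntMatrix I.n w)} :=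
  Iff.rfl

/-- Monotonicity of `SolvesGIVP` in the length bound (eventually, on large dimensions).
[Regev 2009, Def. 2.8] [folklore] -/
theorem SolvesGIVP.mono {G : UniformQCircuitFamily} {b b' : LatticeInstance → ℝ}
    (h : G.SolvesGIVP b)
    (hb : ∀ᶠ n in atTop, ∀ I : LatticeInstance, I.n = n → I.IsNonsingular → b I ≤ b' I) :
    G.SolvesGIVP b' := by
  filter_upwards [h, hb] with n hn hbn I hIn hI
  exact (hn I hIn hI).trans (G.kernelProb_mono _ fun w hw => GIVP.IsSolution.mono (hbn I hIn hI) hw)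

end UniformQCircuitFamily

/-- The Gaussian parameter bound of Regev's main theorem (Thm 3.1): on an instance `B` of
dimension `n`, `φ(B) = √(2n) · η_{ε(n)}(L(B)) / α(n)` with `η` the smoothing parameter
(`Literature.Algebra.EuclideanLattices.smoothingParameter`, Micciancio–Regev 2007, Def. 3.1).
[cite: Regev2009, Thm 3.1] -/
def regevDGSBound (α : ℕ → ℝ) (ε : ℕ → ℝ) (I : LatticeInstance) : ℝ :=
  Real.sqrt (2 * I.n) * smoothingParameter I.lattice (ε I.n) / α I.n

/-! ### The negligible function `ε(n) = e^{-(ln n)²}/10` -/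

/-- The smoothing error used in the assembly: `ε(n) = exp(-(ln n)²)/10 = n^{-ln n}/10`, a
negligible function with `0 < ε(n) ≤ 1/10` and `ln(1/ε(n)) = O((ln n)²)` (Regev 2009, remark
after Lemma 2.12: a negligible `ε` with `η_ε ≤ √(ω(log n)) λₙ`). [cite: Regev2009, Lemma 2.12] -/
def regevEpsilon (n : ℕ) : ℝ :=
  Real.exp (-Real.log n ^ 2) / 10

/-- `0 < ε(n)`. [folklore] -/
theorem regevEpsilon_pos (n : ℕ) : 0 < regevEpsilon n := by
  unfold regevEpsilon; positivity

/-- `ε(n) ≤ 1/10`. [folklore] -/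
theorem regevEpsilon_le (n : ℕ) : regevEpsilon n ≤ 1 / 10 := by
  unfold regevEpsilon
  have : Real.exp (-Real.log n ^ 2) ≤ 1 := Real.exp_le_one_iff.2 (by nlinarith [sq_nonneg (Real.log n)])
  linarith

/-- `1/ε(n) = 10 · exp((ln n)²)`. [folklore] -/
theorem one_div_regevEpsilon (n : ℕ) : 1 / regevEpsilon n = 10 * Real.exp (Real.log n ^ 2) := by
  unfold regevEpsilon
  rw [Real.exp_neg]
  field_simp

/-- `ε(n) = e^{-(ln n)²}/10` is negligible: `n^c ε(n) ≤ 1/n` as soon as `ln n ≥ c + 1`.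
[Regev 2009, §2 (negligible functions), Lemma 2.12] [folklore] -/
theorem isNegligible_regevEpsilon : IsNegligible regevEpsilon := by
  intro c
  have hbound : ∀ᶠ n : ℕ in atTop, (n : ℝ) ^ c * regevEpsilon n ≤ (n : ℝ)⁻¹ := by
    have h1 : ∀ᶠ n : ℕ in atTop, Real.exp (c + 1) ≤ n :=
      tendsto_natCast_atTop_atTop.eventually_ge_atTop _
    filter_upwards [h1, eventually_ge_atTop 1] with n hn hn1
    have hn0 : (0 : ℝ) < n := by exact_mod_cast hn1
    have hlog : (c : ℝ) + 1 ≤ Real.log n := by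
      rw [Real.le_log_iff_exp_le hn0]; exact hn
    have hc0 : (0 : ℝ) ≤ c := Nat.cast_nonneg c
    -- n^c * exp(-(log n)^2) / 10 ≤ exp (c log n - (log n)^2) ≤ exp (- log n) = n⁻¹
    have hpow : (n : ℝ) ^ c = Real.exp (c * Real.log n) := by
      rw [← Real.rpow_natCast, Real.rpow_def_of_pos hn0, mul_comm]
    unfold regevEpsilon
    rw [hpow, show ((n : ℝ))⁻¹ = Real.exp (-Real.log n) by rw [Real.exp_neg, Real.exp_log hn0]]
    calc Real.exp (c * Real.log n) * (Real.exp (-Real.log n ^ 2) / 10)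
        ≤ Real.exp (c * Real.log n) * Real.exp (-Real.log n ^ 2) := by
          have := Real.exp_pos (-Real.log n ^ 2)
          have := Real.exp_pos (c * Real.log n)
          nlinarith
      _ = Real.exp (c * Real.log n - Real.log n ^ 2) := by rw [← Real.exp_add]; ring_nf
      _ ≤ Real.exp (-Real.log ↑n) := by
          rw [Real.exp_le_exp]
          nlinarith
  have hnonneg : ∀ n : ℕ, 0 ≤ (n : ℝ) ^ c * regevEpsilon n := fun n =>
    mul_nonneg (by positivity) (regevEpsilon_pos n).le
  exact squeeze_zero' (Eventually.of_forall hnonneg) hbound tendsto_inv_atTop_nhds_zero_nat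

/-- The logarithmic factor of Lemma 2.12 at `ε = regevEpsilon`: for `n ≥ 8`,
`ln(2n(1 + 1/ε(n))) ≤ 3 (ln n)²`. [Regev 2009, Lemma 2.12 (remark: `η_ε ≤ √(ω(log n)) λₙ` for a
negligible `ε`)] [folklore] -/
theorem log_two_mul_mul_one_add_one_div_regevEpsilon_le {n : ℕ} (hn : 8 ≤ n) :
    Real.log (2 * n * (1 + 1 / regevEpsilon n)) ≤ 3 * Real.log n ^ 2 := by
  have hn0 : (0 : ℝ) < n := by exact_mod_cast (show 0 < n by omega)
  have hn8 : (8 : ℝ) ≤ n := by exact_mod_cast hn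
  -- `log n ≥ log 8 = 3 log 2 > 2`
  have hL2 : 2 ≤ Real.log n := by
    have h8 : Real.log 8 = 3 * Real.log 2 := by
      rw [show (8 : ℝ) = 2 ^ 3 by norm_num, Real.log_pow]; norm_num
    have : Real.log 8 ≤ Real.log n := Real.log_le_log (by norm_num) hn8
    have := Real.log_two_gt_d9
    linarith
  have hE : 1 ≤ Real.exp (Real.log n ^ 2) := Real.one_le_exp (by positivity)
  -- `2n(1 + 10 e^{L²}) ≤ 22 n e^{L²} ≤ e⁵ · e^{L} · e^{L²}` (`e⁵ ≥ 2⁵ = 32`)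
  have h5 : (22 : ℝ) ≤ Real.exp 5 := by
    have h2 : (2 : ℝ) ≤ Real.exp 1 := by
      have := Real.add_one_le_exp (1 : ℝ); norm_num at this; exact this
    have : Real.exp 5 = Real.exp 1 ^ 5 := by rw [← Real.exp_nat_mul]; norm_num
    rw [this]
    have h32 : (2 : ℝ) ^ 5 ≤ Real.exp 1 ^ 5 := pow_le_pow_left₀ (by norm_num) h2 5
    linarith [h32]
  have hnE : 0 ≤ (n : ℝ) * Real.exp (Real.log n ^ 2) := by positivity
  have hx : 2 * n * (1 + 1 / regevEpsilon n) ≤ Real.exp (5 + Real.log n + Real.log n ^ 2) := by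
    rw [one_div_regevEpsilon, Real.exp_add, Real.exp_add, Real.exp_log hn0]
    calc 2 * (n : ℝ) * (1 + 10 * Real.exp (Real.log n ^ 2))
        = 2 * n + 20 * (n * Real.exp (Real.log n ^ 2)) := by ring
      _ ≤ 2 * (n * Real.exp (Real.log n ^ 2)) + 20 * (n * Real.exp (Real.log n ^ 2)) := by
          nlinarith [mul_le_mul_of_nonneg_left hE hn0.le]
      _ = 22 * (n * Real.exp (Real.log n ^ 2)) := by ring
      _ ≤ Real.exp 5 * (n * Real.exp (Real.log n ^ 2)) := mul_le_mul_of_nonneg_right h5 hnE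
      _ = Real.exp 5 * n * Real.exp (Real.log n ^ 2) := by ring
  have hpos : 0 < 2 * n * (1 + 1 / regevEpsilon n) := by
    have := regevEpsilon_pos n; positivity
  calc Real.log (2 * n * (1 + 1 / regevEpsilon n))
      ≤ Real.log (Real.exp (5 + Real.log n + Real.log n ^ 2)) := Real.log_le_log hpos hx
    _ = 5 + Real.log n + Real.log n ^ 2 := Real.log_exp _
    _ ≤ 3 * Real.log n ^ 2 := by
        nlinarith [mul_nonneg (sub_nonneg.2 hL2) (by linarith : (0 : ℝ) ≤ 2 * Real.log n + 3)]

/-- For `n ≥ 8`: `√(ln(2n(1 + 1/ε(n)))/π) ≤ ln n`. [Regev 2009, Lemma 2.12] [folklore] -/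
theorem sqrt_log_div_pi_le_log {n : ℕ} (hn : 8 ≤ n) :
    Real.sqrt (Real.log (2 * n * (1 + 1 / regevEpsilon n)) / Real.pi) ≤ Real.log n := by
  have hL0 : 0 ≤ Real.log n := Real.log_natCast_nonneg n
  rw [Real.sqrt_le_left hL0]
  have h := log_two_mul_mul_one_add_one_div_regevEpsilon_le hn
  have hπ : 3 < Real.pi := Real.pi_gt_three
  rw [div_le_iff₀ Real.pi_pos]
  nlinarith [sq_nonneg (Real.log n)]

/-! ### Assembly: pqc.S19 from Thm 3.1, Lemma 3.17 and Lemma 2.12 -/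

/-- The approximation factor of the assembly: `γ(n) = max(1, 2√2 · n · √(ln(2n(1+1/ε(n)))/π) / α(n))`
with `ε = regevEpsilon`. [Regev 2009, Lemma 3.17 with Lemma 2.12 (`SIVP_{Õ(n/α)}`)] [cite: Regev2009, Lemma 3.17] -/
def regevGamma (α : ℕ → ℝ) (n : ℕ) : ℝ :=
  max 1 (2 * Real.sqrt 2 * n * Real.sqrt (Real.log (2 * n * (1 + 1 / regevEpsilon n)) / Real.pi) / α n)

/-- `1 ≤ γ(n)`. [folklore] -/
theorem one_le_regevGamma (α : ℕ → ℝ) (n : ℕ) : 1 ≤ regevGamma α n :=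
  le_max_left _ _

/-- `γ = Õ(n/α)`: indeed `γ(n) ≤ (1 + 2√2) · (n/α(n)) · ln n` as soon as `n ≥ 8` and
`0 < α(n) < 1`. [Regev 2009, Thm 1.1 / Lemma 3.17 (`Õ(n/α)`)] [folklore] -/
theorem isSoftBigO_regevGamma {α : ℕ → ℝ} (hα : ∀ᶠ n : ℕ in atTop, 0 < α n ∧ α n < 1) :
    IsSoftBigO (regevGamma α) fun n => n / α n := by
  refine ⟨1, IsBigO.of_bound (1 + 2 * Real.sqrt 2) ?_⟩
  filter_upwards [hα, eventually_ge_atTop 8] with n hαn hn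
  obtain ⟨hα0, hα1⟩ := hαn
  have hn8 : (8 : ℝ) ≤ n := by exact_mod_cast hn
  set L := Real.log n with hL
  have hL2 : 2 ≤ L := by
    have h8 : Real.log 8 = 3 * Real.log 2 := by
      rw [show (8 : ℝ) = 2 ^ 3 by norm_num, Real.log_pow]; norm_num
    have : Real.log 8 ≤ L := Real.log_le_log (by norm_num) hn8
    have := Real.log_two_gt_d9
    linarith
  have hsq := sqrt_log_div_pi_le_log hn
  rw [← hL] at hsq
  have hf : 0 < (n : ℝ) / α n * L := by positivity
  have hnorm : ‖(n : ℝ) / α n * L ^ 1‖ = (n : ℝ) / α n * L := by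
    rw [pow_one, Real.norm_of_nonneg hf.le]
  rw [hnorm, Real.norm_of_nonneg (le_trans zero_le_one (one_le_regevGamma α n))]
  -- `1 ≤ n L / α` and `γ₀ ≤ 2√2 n L / α`
  have hnL : 1 ≤ (n : ℝ) / α n * L := by
    have h1 : (n : ℝ) ≤ n / α n := by
      rw [le_div_iff₀ hα0]; nlinarith
    nlinarith
  have hγ0 : 2 * Real.sqrt 2 * n * Real.sqrt (Real.log (2 * n * (1 + 1 / regevEpsilon n)) / Real.pi)
      / α n ≤ 2 * Real.sqrt 2 * ((n : ℝ) / α n * L) := by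
    rw [div_le_iff₀ hα0, show 2 * Real.sqrt 2 * ((n : ℝ) / α n * L) * α n =
      2 * Real.sqrt 2 * n * L by field_simp]
    have : 0 ≤ 2 * Real.sqrt 2 * (n : ℝ) := by positivity
    exact mul_le_mul_of_nonneg_left hsq this
  unfold regevGamma
  refine max_le ?_ ?_
  · nlinarith [Real.sqrt_nonneg 2]
  · nlinarith [Real.sqrt_nonneg 2]

section Assembly

variable (q : ℕ → ℕ) [∀ n, NeZero (q n)] (α : ℕ → ℝ) (m : ℕ → ℕ)

/-- Lemma 2.12 applied on an integer lattice instance: for `B` nonsingular of dimension `n` and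
`0 < ε`, `2√n · (√(2n) η_ε(L(B)) / a) ≤ (2√2 · n · √(ln(2n(1+1/ε))/π) / a) · λₙ(L(B))` for
`a > 0`. [Regev 2009, Lemma 2.12 (= Micciancio–Regev 2007, Lemma 3.3)] [cite: Regev2009, Lemma 2.12] -/
theorem two_sqrt_mul_regevDGSBound_le {I : LatticeInstance} (hI : I.IsNonsingular) {ε a : ℝ}
    (hε : 0 < ε) (ha : 0 < a) :
    2 * Real.sqrt I.n * (Real.sqrt (2 * I.n) * smoothingParameter I.lattice ε / a) ≤
      2 * Real.sqrt 2 * I.n * Real.sqrt (Real.log (2 * I.n * (1 + 1 / ε)) / Real.pi) / a *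
        successiveMinimum I.lattice I.n := by
  haveI := LatticeInstance.isZLattice_of_isNonsingular hI
  have h212 := smoothingParameter_le_sqrt_log_mul_successiveMinimum_holds (L := I.lattice) hε
  rw [finrank_euclideanSpace_fin] at h212
  have hsqrt : Real.sqrt (2 * I.n) = Real.sqrt 2 * Real.sqrt I.n :=
    Real.sqrt_mul (by norm_num) _
  have hnn : Real.sqrt (I.n : ℝ) * Real.sqrt I.n = I.n := Real.mul_self_sqrt (Nat.cast_nonneg _)
  rw [hsqrt]
  calc 2 * Real.sqrt I.n * (Real.sqrt 2 * Real.sqrt I.n * smoothingParameter I.lattice ε / a)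
      = 2 * Real.sqrt 2 * (Real.sqrt I.n * Real.sqrt I.n) * smoothingParameter I.lattice ε / a := by
        ring
    _ = 2 * Real.sqrt 2 * I.n / a * smoothingParameter I.lattice ε := by
        rw [hnn]; ring
    _ ≤ 2 * Real.sqrt 2 * I.n / a *
        (Real.sqrt (Real.log (2 * I.n * (1 + 1 / ε)) / Real.pi) *
          successiveMinimum I.lattice I.n) :=
        mul_le_mul_of_nonneg_left h212 (by positivity)
    _ = _ := by ring

/-- **Assembly of pqc.S19 from Regev's Thm 3.1 and Lemma 3.17.** The two hypotheses are the
machine forms of two printed results of Regev 2009 (they are NOT proved here; a split of the named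
fact `regev_lwe_to_sivp_quantum` would vendor them as the named facts `regev_lwe_to_dgs_quantum`,
`regev_dgs_to_givp_quantum`):

* `hB` — **Thm 3.1 (main theorem)**, PRINTED: let `ε = ε(n)` be negligible, `p = p(n)` an integer
  and `α = α(n) ∈ (0,1)` with `αp > 2√n`; assume access to an oracle `W` that solves `LWE_{p,Ψ_α}`
  given a polynomial number of samples ("solves": for EVERY `s`, outputs `s` with probability
  exponentially close to `1`, §2 p. 12); then there is an efficient quantum algorithm for
  `DGS_{√(2n)·η_ε(L)/α}`. MACHINE FORM: under the hypotheses of pqc.S19 except `IsPolyBounded q`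
  (one poly-time uniform quantum family with AVERAGE-case success `≥ 2/3` on `m(n)` samples of
  `LWE_{q,Ψ̄_α}`, `m` polynomially bounded, `IsPolyTimeParams q α m`, eventually `0 < α < 1` and
  `αq > 2√n`) — which reach Regev's oracle through the paper's own bridge: the shift
  `(a,b) ↦ (a, b + ⟨a,t⟩)` (proof of Lemma 4.1), `n`-fold repetition with the verification
  procedure of Lemma 3.6 (success `≥ 1/2` per call suffices, as in the proof of Lemma 3.7) and
  Lemma 4.3 (`Ψ̄_α` to `Ψ_α`) — for every negligible `ε > 0` some poly-time uniform quantum family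
  `D` solves `DGS_φ`, `φ = regevDGSBound α ε`, up to a negligible statistical distance `ν`
  (`SamplesDGS`; `ν` collects the exponentially small failure probabilities and the `poly(n)·ε`
  distances of Lemma 3.11). Its proof in the paper: Lemma 3.2 (bootstrapping, LLL), `3n` rounds of
  Lemma 3.3 (iterative step) = Lemma 3.4 (classical half: Lemmas 3.5–3.7, 3.11, Claims 3.8–3.10)
  + Lemma 3.14 (quantum half: Lemma 3.12, Claim 3.13, Fourier transform over `ℤ_Rⁿ`).
* `hC` — **Lemma 3.17**, PRINTED: for any `ε(n) ≤ 1/10` and any `φ(L) ≥ √2 η_ε(L)` there is a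
  polynomial-time reduction from `GIVP_{2√n φ}` to `DGS_φ` (LLL; `n²` oracle calls at each radius
  `r_i = λ̃ₙ2^{-i}`, `i ≤ 2n`; Cor. 3.16, Lemma 2.5, Claim 2.13). MACHINE FORM: for such `ε`, `φ`
  (the inequality asked on nonsingular integer instances of large dimension), every poly-time
  uniform quantum `DGS_φ` sampler with negligible error yields a poly-time uniform quantum family
  solving `GIVP` with bound `2√n · φ` (`SolvesGIVP`, success `≥ 2/3`; Regev: exponentially close
  to `1`, the polynomially many sampler calls costing a negligible total error).

PROOF of the assembly (the paragraph before Lemma 3.17 in Regev 2009, "by Lemma 2.12 this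
algorithm also solves `SIVP_{Õ(n/α)}`", made quantitative): take `ε = regevEpsilon` (negligible,
`≤ 1/10`), `φ = regevDGSBound α ε` (`≥ √2 η_ε` as `α < 1 ≤ √n`), `γ = regevGamma α = Õ(n/α)`
(`isSoftBigO_regevGamma`); a `GIVP` solution with bound `2√n φ(B) = 2√2 n η_ε(L(B))/α` is an
`SIVP_γ` solution by the PROVED Lemma 2.12 (`two_sqrt_mul_regevDGSBound_le`).
[cite: Regev2009, Thm 3.1 and Lemma 3.17] -/
theorem regev_lwe_to_sivp_quantum_of_dgs
    (hB : ∀ (_ : IsPolyBounded m) (_ : IsPolyTimeParams q α m)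
      (_ : ∀ᶠ n : ℕ in atTop, 0 < α n ∧ α n < 1 ∧ 2 * Real.sqrt n < α n * q n)
      (_ : ∃ Q : UniformQCircuitFamily, SearchLWESolves q (fun n => discretizedGaussian (q n) (α n))
        m (fun n => Q.searchLWESolver n (q n) (m n)) fun _ => 2 / 3)
      (ε : ℕ → ℝ), IsNegligible ε → (∀ n, 0 < ε n) →
      ∃ (D : UniformQCircuitFamily) (ν : ℕ → ℝ), IsNegligible ν ∧ D.SamplesDGS (regevDGSBound α ε) ν)
    (hC : ∀ (ε : ℕ → ℝ) (φ : LatticeInstance → ℝ), (∀ n, 0 < ε n ∧ ε n ≤ 1 / 10) →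
      (∀ᶠ n in atTop, ∀ I : LatticeInstance, I.n = n → I.IsNonsingular →
        Real.sqrt 2 * smoothingParameter I.lattice (ε n) ≤ φ I) →
      ∀ (D : UniformQCircuitFamily) (ν : ℕ → ℝ), IsNegligible ν → D.SamplesDGS φ ν →
        ∃ G : UniformQCircuitFamily, G.SolvesGIVP fun I => 2 * Real.sqrt I.n * φ I) :
    regev_lwe_to_sivp_quantum q α m := by
  intro _hq hm hpar hα hLWE
  obtain ⟨D, ν, hν, hD⟩ :=
    hB hm hpar hα hLWE regevEpsilon isNegligible_regevEpsilon regevEpsilon_pos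
  have hα' : ∀ᶠ n : ℕ in atTop, 0 < α n ∧ α n < 1 := hα.mono fun n h => ⟨h.1, h.2.1⟩
  -- the bound `φ = √(2n) η_ε / α` dominates `√2 η_ε` in large dimension
  have hφ : ∀ᶠ n in atTop, ∀ I : LatticeInstance, I.n = n → I.IsNonsingular →
      Real.sqrt 2 * smoothingParameter I.lattice (regevEpsilon n) ≤
        regevDGSBound α regevEpsilon I := by
    filter_upwards [hα', eventually_ge_atTop 1] with n hαn hn1 I hIn _hI
    obtain ⟨hα0, hα1⟩ := hαn
    subst hIn
    have hη : 0 ≤ smoothingParameter I.lattice (regevEpsilon I.n) := smoothingParameter_nonneg _ _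
    have hn1' : (1 : ℝ) ≤ I.n := by exact_mod_cast hn1
    have hsn : 1 ≤ Real.sqrt (I.n : ℝ) := by
      rw [show (1 : ℝ) = Real.sqrt 1 by simp]; exact Real.sqrt_le_sqrt hn1'
    unfold regevDGSBound
    rw [le_div_iff₀ hα0, Real.sqrt_mul (by norm_num : (0 : ℝ) ≤ 2)]
    calc Real.sqrt 2 * smoothingParameter I.lattice (regevEpsilon I.n) * α I.n
        ≤ Real.sqrt 2 * smoothingParameter I.lattice (regevEpsilon I.n) * 1 := by
          gcongr
      _ ≤ Real.sqrt 2 * Real.sqrt I.n * smoothingParameter I.lattice (regevEpsilon I.n) := by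
          nlinarith [Real.sqrt_nonneg 2, mul_nonneg (Real.sqrt_nonneg 2) hη]
  obtain ⟨G, hG⟩ := hC regevEpsilon (regevDGSBound α regevEpsilon)
    (fun n => ⟨regevEpsilon_pos n, regevEpsilon_le n⟩) hφ D ν hν hD
  refine ⟨regevGamma α, one_le_regevGamma α, isSoftBigO_regevGamma hα', G, ?_⟩
  -- a `GIVP` solution with bound `2√n φ(B) = 2√2 n η_ε(L(B))/α` is an `SIVP_γ` solution (Lemma 2.12)
  rw [← UniformQCircuitFamily.solvesGIVP_iff_sivp]
  refine hG.mono ?_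
  filter_upwards [hα'] with n hαn I hIn hI
  subst hIn
  refine (two_sqrt_mul_regevDGSBound_le hI (regevEpsilon_pos I.n) hαn.1).trans ?_
  exact mul_le_mul_of_nonneg_right (le_max_right _ _) (successiveMinimum_nonneg _ _)

end Assembly

end Literature.Computability.Cryptography

end
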